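import Mathlib

/-!
# P8SylowTransitive — a transitive group of prime-power degree has transitive Sylow subgroups (cell pub-hodge-repro0, seat p8 (g6))

The lemma behind the SEEDS of the seat's enumeration of the 50 transitive subgroups of `S₈` (proofs/p8-Dim8SecondPath-v1.4.md
§20(a), step (1); STATUS l.2423 (1)): every transitive `K ≤ S₈` contains a transitive 2-subgroup — a Sylow 2-subgroup of `K` —
so (Sylow's theorem) a conjugate of a transitive subgroup of the fixed Sylow 2-subgroup `P₁₂₈`, which is why the expansion by
single-element joins may start from the transitive subgroups of `P₁₂₈`. `sylow_isPretransitive` is the general statement (a finite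
group acting transitively on a set of `p ^ k` elements: every Sylow `p`-subgroup acts transitively), proved by orbit–stabiliser
counting: `|X| · |G_x| = |G|`, `|P| = p ^ v_p(|G|) = p ^ (k + v_p(|G_x|))`, the stabiliser `P_x ≤ G_x` is a `p`-group, so
`|P_x| ≤ p ^ v_p(|G_x|)` and the `P`-orbit of `x` has at least `p ^ k = |X|` points. `sylow2_transitive_of_transitive` is the case
`G = K ≤ S₈`, `X = Fin 8`, `p = 2`, `k = 3`. NOT formalised here: that `P₁₂₈` is a Sylow 2-subgroup of `S₈` (order `128 = 2 ^ 7`,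
a closure computation) and the completeness induction of the expansion (paper, §20(a) step (2)).
-/

namespace HodgeRepro0.P8SylowTransitive

open MulAction

/-- the key lemma of the enumeration of the transitive subgroups of `S₈` (p8-Dim8SecondPath-v1.4 §20(a)):
if a finite group `G` acts transitively on a finite set `X` with `|X| = p ^ k` (`p` prime), then every Sylow
`p`-subgroup `P` of `G` acts transitively on `X` -/
theorem sylow_isPretransitive {G X : Type*} [Group G] [Fintype G] [MulAction G X] [Fintype X]
    (p : ℕ) [hp : Fact p.Prime] (k : ℕ) (hX : Fintype.card X = p ^ k) [hG : IsPretransitive G X]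
    (P : Sylow p G) : IsPretransitive (↥(P : Subgroup G)) X := by
  classical
  have hXpos : 0 < Fintype.card X := by rw [hX]; exact pow_pos hp.out.pos k
  obtain ⟨x⟩ : Nonempty X := Fintype.card_pos_iff.mp hXpos
  -- orbit–stabiliser for G at x: |X| * |G_x| = |G|
  have hG1 : Fintype.card X * Fintype.card (stabilizer G x) = Fintype.card G := by
    have h := card_orbit_mul_card_stabilizer_eq_card_group G x
    have : Fintype.card (orbit G x) = Fintype.card X :=
      Fintype.card_eq.mpr ⟨(Equiv.setCongr (orbit_eq_univ G x)).trans (Equiv.Set.univ X)⟩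
    rwa [this] at h
  -- orbit–stabiliser for P at x
  have hP1 : Fintype.card (orbit (↥(P : Subgroup G)) x) * Fintype.card (stabilizer (↥(P : Subgroup G)) x)
      = Fintype.card (↥(P : Subgroup G)) := card_orbit_mul_card_stabilizer_eq_card_group _ x
  -- |P| = p ^ v_p(|G|)
  have hPcard : Fintype.card (↥(P : Subgroup G)) = p ^ (Fintype.card G).factorization p := by
    have := P.card_eq_multiplicity
    simpa [Nat.card_eq_fintype_card] using this
  -- the stabiliser in P is a p-group whose order divides |G_x|
  obtain ⟨m, hm⟩ : ∃ m, Fintype.card (stabilizer (↥(P : Subgroup G)) x) = p ^ m := by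
    have hpg : IsPGroup p (stabilizer (↥(P : Subgroup G)) x) := IsPGroup.to_subgroup P.isPGroup' _
    obtain ⟨n, hn⟩ := (IsPGroup.iff_card).mp hpg
    exact ⟨n, by simpa [Nat.card_eq_fintype_card] using hn⟩
  have hdvd : Fintype.card (stabilizer (↥(P : Subgroup G)) x) ∣ Fintype.card (stabilizer G x) := by
    let f : stabilizer (↥(P : Subgroup G)) x →* stabilizer G x :=
      { toFun := fun g => ⟨((g : ↥(P : Subgroup G)) : G), by
          have h2 : (g : ↥(P : Subgroup G)) • x = x := g.2
          exact h2⟩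
        map_one' := rfl
        map_mul' := fun a b => rfl }
    have hf : Function.Injective f := by
      intro a b hab
      apply Subtype.ext; apply Subtype.ext
      exact congrArg (fun y : stabilizer G x => (y : G)) hab
    have := Subgroup.card_dvd_of_injective f hf
    simpa [Nat.card_eq_fintype_card] using this
  -- the arithmetic: v_p(|G|) = k + v_p(|G_x|), m ≤ v_p(|G_x|), so |orbit_P x| = p ^ (v_p(|G|) - m) ≥ p ^ k = |X|
  have ha0 : 0 < Fintype.card (stabilizer G x) := Fintype.card_pos
  have hf : (Fintype.card G).factorization p = k + (Fintype.card (stabilizer G x)).factorization p := by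
    rw [← hG1, hX, Nat.factorization_mul (pow_ne_zero k hp.out.ne_zero) ha0.ne', Finsupp.add_apply,
      Nat.factorization_pow, Finsupp.smul_apply, hp.out.factorization_self, smul_eq_mul, mul_one]
  have hmv : m ≤ (Fintype.card (stabilizer G x)).factorization p :=
    (hp.out.pow_dvd_iff_le_factorization ha0.ne').mp (hm ▸ hdvd)
  set o := Fintype.card (orbit (↥(P : Subgroup G)) x) with ho
  have h3 : o * p ^ m = p ^ (k + (Fintype.card (stabilizer G x)).factorization p) := by
    rw [← hf, ← hPcard, ← hP1, hm]
  have h4 : o = p ^ (k + (Fintype.card (stabilizer G x)).factorization p - m) := by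
    have h5 : p ^ (k + (Fintype.card (stabilizer G x)).factorization p) =
        p ^ (k + (Fintype.card (stabilizer G x)).factorization p - m) * p ^ m := by
      rw [← pow_add, Nat.sub_add_cancel (by omega)]
    exact Nat.eq_of_mul_eq_mul_right (pow_pos hp.out.pos m) (h3.trans h5)
  have h6 : p ^ k ≤ o := by
    rw [h4]; exact Nat.pow_le_pow_right hp.out.pos (by omega)
  have h7 : o ≤ Fintype.card X := Fintype.card_le_of_injective _ Subtype.val_injective
  have huniv : orbit (↥(P : Subgroup G)) x = Set.univ := by
    apply Set.eq_of_subset_of_card_le (Set.subset_univ _)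
    calc Fintype.card (Set.univ : Set X) = Fintype.card X := Fintype.card_eq.mpr ⟨Equiv.Set.univ X⟩
      _ = p ^ k := hX
      _ ≤ o := h6
  refine ⟨fun y z => ?_⟩
  obtain ⟨gy, hgy⟩ := mem_orbit_iff.mp (show y ∈ orbit (↥(P : Subgroup G)) x by rw [huniv]; exact Set.mem_univ y)
  obtain ⟨gz, hgz⟩ := mem_orbit_iff.mp (show z ∈ orbit (↥(P : Subgroup G)) x by rw [huniv]; exact Set.mem_univ z)
  exact ⟨gz * gy⁻¹, by rw [mul_smul, ← hgy, inv_smul_smul, hgz]⟩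

/-- the case of the enumeration: a transitive subgroup `K ≤ S₈` has transitive Sylow 2-subgroups -/
theorem sylow2_transitive_of_transitive (K : Subgroup (Equiv.Perm (Fin 8))) [Fintype K]
    [IsPretransitive K (Fin 8)] (P : Sylow 2 K) : IsPretransitive (↥(P : Subgroup K)) (Fin 8) :=
  sylow_isPretransitive 2 3 (by simp) P

end HodgeRepro0.P8SylowTransitive
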